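import Mathlib.Analysis.SpecialFunctions.ExpDeriv
import Mathlib.Analysis.SpecialFunctions.Sqrt
import Mathlib.Analysis.Calculus.Deriv.MeanValue
import Mathlib.Analysis.Calculus.Deriv.Polynomial
import Mathlib.Analysis.Calculus.Deriv.Inv
import Literature.Analysis.SpecialFunctions.LaguerrePolynomial
import HarnessLib

/-!
# The Szegő normal form `w(t) = e^{-t²/2} tⁿ L_d^{(n-1/2)}(t²)` and its two Sonin envelope functions

For the generalized Laguerre polynomial `L = L_d^{(α)}` with the HALF-INTEGER parameter
`α = n - 1/2` (`n, d ∈ ℕ`), the third differential equation of Szegő (5.1.2) says that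

  `w(t) := e^{-t²/2} t^{α + 1/2} L_d^{(α)}(t²) = e^{-t²/2} tⁿ L_d^{(n-1/2)}(t²)`

solves `w″ + Q w = 0` with `Q(t) = 4d + 2α + 2 - t² + (1/4 - α²)/t² = (4d + 2n + 1) - t² - n(n-1)/t²`
— for `α = n - 1/2` every datum is an integer (`laguerreNormal`, `laguerreNormalQ`,
`hasDerivAt_laguerreNormal`, `hasDerivAt_laguerreNormalDeriv`). `Q` increases on `(0, t_M]` and
decreases on `[t_M, ∞)`, `t_M = (n(n-1))^{1/4}` (`laguerrePeak`), and is positive exactly on the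
"oscillatory interval" `(t₋, t₊)`, `t_∓² = (c ∓ √(c² - 4n(n-1)))/2`, `c = 4d + 2n + 1`
(`laguerreTMinus`, `laguerreTPlus`, `laguerreNormalQ_pos_iff`). Sonin's classical device
(Szegő §7.31, proof of Thm. 7.31.1) then gives the two ENVELOPE functions

* `G = Q w² + w′²` with `G′ = Q′ w²` (`soninG`, `hasDerivAt_soninG`): maximal at `t_M`,
  `G(t) ≤ G(t_M)` for every `t > 0` (`soninG_le_peak`);
* `F = w² + w′²/Q` with `F′ = -Q′ w′²/Q²` on `(t₋, t₊)`: minimal at `t_M` — this second function,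
  the oscillatory interval and the consequences at the critical points of `w` are in the sequel
  `LaguerreSoninOscillatory.lean` (split for length).

This file: the normal form, its equation, `Q′`, the peak `t_M`, and `G(t) ≤ G(t_M)` for `t > 0`.
Pure real analysis; no orthogonality is used. Consumer: the all-degree hyperbolicity threshold for the
Jensen polynomials of `ξ` (`Literature/NumberTheory/LFunctions/JensenXiExponentialRange.lean`).

## References
* [Szego1975] G. Szegő, *Orthogonal Polynomials*, 4th ed. (1975), (5.1.2) (the differential equations
  of `L_n^{(α)}`, third form), §7.31 / Thm. 7.31.1 (Sonin's theorem on the monotonicity of the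
  successive extrema of solutions of `(k y′)′ + φ y = 0`), Thm. 6.31.2 (the zeros lie where `Q > 0`).
-/

noncomputable section

open Polynomial Set

namespace Literature.Analysis.SpecialFunctions

variable (n d : ℕ)

/-! ### The normal form and its differential equation -/

/-- **Szegő's third normal form** of the Laguerre equation at the half-integer parameter
`α = n - 1/2`: `w(t) = e^{-t²/2} · tⁿ · L_d^{(n-1/2)}(t²)`. [cite: Szego1975, (5.1.2)] -/
def laguerreNormal (t : ℝ) : ℝ :=
  Real.exp (-(t ^ 2 / 2)) * t ^ n * (laguerre ((n : ℝ) - 1 / 2) d).eval (t ^ 2)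

/-- The derivative `w′(t) = e^{-t²/2} tⁿ ((n/t - t) L(t²) + 2t L′(t²))` (`t ≠ 0`).
[cite: Szego1975, (5.1.2)] -/
def laguerreNormalDeriv (t : ℝ) : ℝ :=
  Real.exp (-(t ^ 2 / 2)) * t ^ n *
    (((n : ℝ) / t - t) * (laguerre ((n : ℝ) - 1 / 2) d).eval (t ^ 2)
      + 2 * t * (derivative (laguerre ((n : ℝ) - 1 / 2) d)).eval (t ^ 2))

/-- The potential `Q(t) = (4d + 2n + 1) - t² - n(n-1)/t²` of the normal form `w″ + Q w = 0`
(Szegő (5.1.2) with `α = n - 1/2`: `4d + 2α + 2 = 4d + 2n + 1`, `α² - 1/4 = n(n-1)`).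
[cite: Szego1975, (5.1.2)] -/
def laguerreNormalQ (t : ℝ) : ℝ :=
  4 * (d : ℝ) + 2 * n + 1 - t ^ 2 - (n : ℝ) * ((n : ℝ) - 1) / t ^ 2

/-- `Q′(t) = -2t + 2n(n-1)/t³`. [cite: Szego1975, (5.1.2)] -/
def laguerreNormalQDeriv (n : ℕ) (t : ℝ) : ℝ :=
  -(2 * t) + 2 * ((n : ℝ) * ((n : ℝ) - 1)) / t ^ 3

/-- `d/dt tⁿ = (n/t) tⁿ` for `t ≠ 0` (also for `n = 0`). [folklore] -/
private theorem hasDerivAt_pow_div_mul {t : ℝ} (ht : t ≠ 0) :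
    HasDerivAt (fun x : ℝ => x ^ n) ((n : ℝ) / t * t ^ n) t := by
  refine (hasDerivAt_pow n t).congr_deriv ?_
  rcases n with _ | k
  · simp
  · rw [Nat.add_sub_cancel, pow_succ]
    field_simp

/-- `d/dt e^{-t²/2} = -t · e^{-t²/2}`. [folklore] -/
private theorem hasDerivAt_exp_neg_sq_half (t : ℝ) :
    HasDerivAt (fun x : ℝ => Real.exp (-(x ^ 2 / 2))) (Real.exp (-(t ^ 2 / 2)) * (-t)) t := by
  have h1 : HasDerivAt (fun x : ℝ => -(x ^ 2 / 2)) (-t) t := by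
    have := ((hasDerivAt_pow 2 t).div_const 2).neg
    refine this.congr_deriv ?_
    push_cast
    ring
  exact (Real.hasDerivAt_exp _).comp t h1

/-- **`w′`**: for `t ≠ 0`, `HasDerivAt w (w′ t) t` with the explicit `w′ = laguerreNormalDeriv`.
[cite: Szego1975, (5.1.2)] -/
theorem hasDerivAt_laguerreNormal {t : ℝ} (ht : t ≠ 0) :
    HasDerivAt (laguerreNormal n d) (laguerreNormalDeriv n d t) t := by
  set L := laguerre ((n : ℝ) - 1 / 2) d with hL
  have hE : HasDerivAt (fun x : ℝ => Real.exp (-(x ^ 2 / 2)) * x ^ n)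
      (Real.exp (-(t ^ 2 / 2)) * (-t) * t ^ n + Real.exp (-(t ^ 2 / 2)) * ((n : ℝ) / t * t ^ n)) t :=
    (hasDerivAt_exp_neg_sq_half t).mul (hasDerivAt_pow_div_mul n ht)
  have hP : HasDerivAt (fun x : ℝ => L.eval (x ^ 2)) ((derivative L).eval (t ^ 2) * (2 * t)) t := by
    have h2 : HasDerivAt (fun x : ℝ => x ^ 2) (2 * t) t := by
      simpa using hasDerivAt_pow 2 t
    have h := (L.hasDerivAt (t ^ 2)).comp t h2
    exact h
  have h := hE.mul hP
  refine h.congr_deriv ?_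
  simp only [laguerreNormalDeriv, ← hL]
  ring

/-- **The normal-form equation `w″ = -Q w`** (Szegő (5.1.2), third equation, `α = n - 1/2`):
for `t ≠ 0`, `HasDerivAt w′ (-Q(t) w(t)) t`. From Laguerre's equation
`y L″ + (α + 1 - y) L′ + d L = 0` at `y = t²`. [cite: Szego1975, (5.1.2)] -/
theorem hasDerivAt_laguerreNormalDeriv {t : ℝ} (ht : t ≠ 0) :
    HasDerivAt (laguerreNormalDeriv n d) (-(laguerreNormalQ n d t) * laguerreNormal n d t) t := by
  set L := laguerre ((n : ℝ) - 1 / 2) d with hL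
  -- the pieces
  have hE : HasDerivAt (fun x : ℝ => Real.exp (-(x ^ 2 / 2)) * x ^ n)
      (Real.exp (-(t ^ 2 / 2)) * (-t) * t ^ n + Real.exp (-(t ^ 2 / 2)) * ((n : ℝ) / t * t ^ n)) t :=
    (hasDerivAt_exp_neg_sq_half t).mul (hasDerivAt_pow_div_mul n ht)
  have h2 : HasDerivAt (fun x : ℝ => x ^ 2) (2 * t) t := by simpa using hasDerivAt_pow 2 t
  have hP0 : HasDerivAt (fun x : ℝ => L.eval (x ^ 2)) ((derivative L).eval (t ^ 2) * (2 * t)) t := by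
    have h := (L.hasDerivAt (t ^ 2)).comp t h2
    exact h
  have hP1 : HasDerivAt (fun x : ℝ => (derivative L).eval (x ^ 2))
      ((derivative (derivative L)).eval (t ^ 2) * (2 * t)) t := by
    have h := ((derivative L).hasDerivAt (t ^ 2)).comp t h2
    exact h
  have hA : HasDerivAt (fun x : ℝ => (n : ℝ) / x - x) ((0 * t - (n : ℝ) * 1) / t ^ 2 - 1) t :=
    ((hasDerivAt_const t (n : ℝ)).div (hasDerivAt_id t) ht).sub (hasDerivAt_id t)
  have hB : HasDerivAt (fun x : ℝ => 2 * x) 2 t := by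
    simpa using (hasDerivAt_id t).const_mul 2
  have hM : HasDerivAt (fun x : ℝ => ((n : ℝ) / x - x) * L.eval (x ^ 2)
      + 2 * x * (derivative L).eval (x ^ 2)) _ t := (hA.mul hP0).add (hB.mul hP1)
  have h : HasDerivAt (laguerreNormalDeriv n d) _ t := hE.mul hM
  refine h.congr_deriv ?_
  -- Laguerre's equation at `y = t²`
  have hode := laguerre_ode_eval ((n : ℝ) - 1 / 2) d (t ^ 2)
  rw [← hL] at hode
  simp only [laguerreNormalQ, laguerreNormal, ← hL]
  set e := Real.exp (-(t ^ 2 / 2)) with he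
  set L0 := L.eval (t ^ 2)
  set L1 := (derivative L).eval (t ^ 2)
  set L2 := (derivative (derivative L)).eval (t ^ 2)
  field_simp
  linear_combination (4 * e * t ^ 2) * hode

/-! ### The first Sonin function `G = Q w² + w′²` -/

/-- Sonin's envelope function `G(t) = Q(t) w(t)² + w′(t)²`. [cite: Szego1975, §7.31] -/
def soninG (t : ℝ) : ℝ :=
  laguerreNormalQ n d t * laguerreNormal n d t ^ 2 + laguerreNormalDeriv n d t ^ 2

/-- `Q′`: for `t ≠ 0`, `HasDerivAt Q (Q′ t) t`. [cite: Szego1975, (5.1.2)] -/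
theorem hasDerivAt_laguerreNormalQ {t : ℝ} (ht : t ≠ 0) :
    HasDerivAt (laguerreNormalQ n d) (laguerreNormalQDeriv n t) t := by
  have h2 : HasDerivAt (fun x : ℝ => x ^ 2) (2 * t) t := by simpa using hasDerivAt_pow 2 t
  have hm : HasDerivAt (fun x : ℝ => (n : ℝ) * ((n : ℝ) - 1) / x ^ 2)
      ((0 * t ^ 2 - (n : ℝ) * ((n : ℝ) - 1) * (2 * t)) / (t ^ 2) ^ 2) t :=
    (hasDerivAt_const t _).div h2 (pow_ne_zero 2 ht)
  have h : HasDerivAt (laguerreNormalQ n d) (0 - 2 * t - _) t :=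
    ((hasDerivAt_const t (4 * (d : ℝ) + 2 * n + 1)).sub h2).sub hm
  refine h.congr_deriv ?_
  simp only [laguerreNormalQDeriv]
  field_simp
  ring

/-- **`G′ = Q′ w²`** (the cross terms cancel by `w″ = -Q w`). [cite: Szego1975, §7.31] -/
theorem hasDerivAt_soninG {t : ℝ} (ht : t ≠ 0) :
    HasDerivAt (soninG n d) (laguerreNormalQDeriv n t * laguerreNormal n d t ^ 2) t := by
  have hQ := hasDerivAt_laguerreNormalQ n d ht
  have hw := hasDerivAt_laguerreNormal n d ht
  have hw1 := hasDerivAt_laguerreNormalDeriv n d ht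
  have h : HasDerivAt (soninG n d) _ t := (hQ.mul (hw.pow 2)).add (hw1.pow 2)
  refine h.congr_deriv ?_
  simp only [Pi.pow_apply]
  push_cast
  ring

/-- The peak abscissa `t_M = (n(n-1))^{1/4}` where `Q` is maximal. [cite: Szego1975, §7.31] -/
def laguerrePeak (n : ℕ) : ℝ := Real.sqrt (Real.sqrt ((n : ℝ) * ((n : ℝ) - 1)))

/-- `t_M ^ 4 = n(n-1)` (for `n ≥ 1`, so that `n(n-1) ≥ 0`). [cite: Szego1975, §7.31] -/
theorem laguerrePeak_pow_four (hn : 1 ≤ n) : laguerrePeak n ^ 4 = (n : ℝ) * ((n : ℝ) - 1) := by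
  have hm : 0 ≤ (n : ℝ) * ((n : ℝ) - 1) := by
    have : (1 : ℝ) ≤ n := by exact_mod_cast hn
    exact mul_nonneg (by linarith) (by linarith)
  rw [show (4 : ℕ) = 2 * 2 from rfl, pow_mul, laguerrePeak, Real.sq_sqrt (Real.sqrt_nonneg _),
    Real.sq_sqrt hm]

/-- `t_M > 0` for `n ≥ 2`. [cite: Szego1975, §7.31] -/
theorem laguerrePeak_pos (hn : 2 ≤ n) : 0 < laguerrePeak n := by
  have : (2 : ℝ) ≤ n := by exact_mod_cast hn
  unfold laguerrePeak
  exact Real.sqrt_pos.2 (Real.sqrt_pos.2 (mul_pos (by linarith) (by linarith)))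

/-- `Q′ ≥ 0` on `(0, t_M]`. [cite: Szego1975, §7.31] -/
theorem laguerreNormalQDeriv_nonneg (hn : 1 ≤ n) {t : ℝ} (ht : 0 < t) (htM : t ≤ laguerrePeak n) :
    0 ≤ laguerreNormalQDeriv n t := by
  have h4 : t ^ 4 ≤ (n : ℝ) * ((n : ℝ) - 1) := by
    rw [← laguerrePeak_pow_four n hn]; exact pow_le_pow_left₀ ht.le htM 4
  have e : laguerreNormalQDeriv n t = 2 * ((n : ℝ) * ((n : ℝ) - 1) - t ^ 4) / t ^ 3 := by
    unfold laguerreNormalQDeriv; field_simp; ring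
  rw [e]
  exact div_nonneg (by linarith) (by positivity)

/-- `Q′ ≤ 0` on `[t_M, ∞)`. [cite: Szego1975, §7.31] -/
theorem laguerreNormalQDeriv_nonpos (hn : 1 ≤ n) {t : ℝ} (ht : 0 < t) (htM : laguerrePeak n ≤ t) :
    laguerreNormalQDeriv n t ≤ 0 := by
  have h0 : 0 ≤ laguerrePeak n := by unfold laguerrePeak; exact Real.sqrt_nonneg _
  have h4 : (n : ℝ) * ((n : ℝ) - 1) ≤ t ^ 4 := by
    rw [← laguerrePeak_pow_four n hn]; exact pow_le_pow_left₀ h0 htM 4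
  have e : laguerreNormalQDeriv n t = 2 * ((n : ℝ) * ((n : ℝ) - 1) - t ^ 4) / t ^ 3 := by
    unfold laguerreNormalQDeriv; field_simp; ring
  rw [e]
  exact div_nonpos_of_nonpos_of_nonneg (by linarith) (by positivity)

/-- `G` is continuous at every `t ≠ 0`. [cite: Szego1975, §7.31] -/
theorem continuousAt_soninG {t : ℝ} (ht : t ≠ 0) : ContinuousAt (soninG n d) t :=
  (hasDerivAt_soninG n d ht).continuousAt

/-- **Sonin: `G(t) ≤ G(t_M)` for every `t > 0`** (`G` increases on `(0, t_M]`, decreases on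
`[t_M, ∞)`; `n ≥ 2`). [cite: Szego1975, Thm. 7.31.1] -/
theorem soninG_le_peak (hn : 2 ≤ n) {t : ℝ} (ht : 0 < t) :
    soninG n d t ≤ soninG n d (laguerrePeak n) := by
  have hn1 : 1 ≤ n := le_trans (by norm_num) hn
  have hM := laguerrePeak_pos n hn
  rcases le_or_gt t (laguerrePeak n) with h | h
  · -- increasing on `Ioc 0 t_M`
    have hmono : MonotoneOn (soninG n d) (Icc t (laguerrePeak n)) := by
      refine monotoneOn_of_hasDerivWithinAt_nonneg (convex_Icc _ _)
        (f' := fun x => laguerreNormalQDeriv n x * laguerreNormal n d x ^ 2)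
        (fun x hx => (continuousAt_soninG n d (lt_of_lt_of_le ht hx.1).ne').continuousWithinAt)
        (fun x hx => ?_) (fun x hx => ?_)
      · rw [interior_Icc] at hx
        exact (hasDerivAt_soninG n d (lt_trans ht hx.1).ne').hasDerivWithinAt
      · rw [interior_Icc] at hx
        exact mul_nonneg (laguerreNormalQDeriv_nonneg n hn1 (lt_trans ht hx.1) hx.2.le) (sq_nonneg _)
    exact hmono (left_mem_Icc.2 h) (right_mem_Icc.2 h) h
  · -- decreasing on `Ici t_M`
    have hanti : AntitoneOn (soninG n d) (Icc (laguerrePeak n) t) := by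
      refine antitoneOn_of_hasDerivWithinAt_nonpos (convex_Icc _ _)
        (f' := fun x => laguerreNormalQDeriv n x * laguerreNormal n d x ^ 2)
        (fun x hx => (continuousAt_soninG n d (lt_of_lt_of_le hM hx.1).ne').continuousWithinAt)
        (fun x hx => ?_) (fun x hx => ?_)
      · rw [interior_Icc] at hx
        exact (hasDerivAt_soninG n d (lt_trans hM hx.1).ne').hasDerivWithinAt
      · rw [interior_Icc] at hx
        exact mul_nonpos_of_nonpos_of_nonneg
          (laguerreNormalQDeriv_nonpos n hn1 (lt_trans hM hx.1) hx.1.le) (sq_nonneg _)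
    exact hanti (left_mem_Icc.2 h.le) (right_mem_Icc.2 h.le) h.le

end Literature.Analysis.SpecialFunctions
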